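import Summits.ResolutionOfSingularities.ResolutionOfSingularities.Theses.TropicalLinks
import Literature.AlgebraicGeometry.Resolution.NonReducedNoResolution
import Literature.AlgebraicGeometry.Resolution.AbsoluteIntegralClosureNoResolution
import Literature.AlgebraicGeometry.Tropical.SchonIdeal
import Summits.ResolutionOfSingularities.ResolutionOfSingularities.Theorems.SchonResolves.Negative.SchonResolvesLoadBearing
import Summits.ResolutionOfSingularities.ResolutionOfSingularities.Theorems.SchonResolves.Negative.InitialFormMul
import Summits.ResolutionOfSingularities.ResolutionOfSingularities.Theorems.SchonResolves.Negative.AntecedentNeedsReembedding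
import Summits.ResolutionOfSingularities.ResolutionOfSingularities.Theorems.SchonResolves.Negative.AntecedentForallFalse
import Summits.ResolutionOfSingularities.ResolutionOfSingularities.Theorems.SchonResolves.Negative.AntecedentChoiceAtTorus

/-!
# Disproof of `SchonResolves` (crux stmt-ResolutionOfSingularities-17234, route TropicalLinks) — findings

Standing disprover's work file (cdisprove, cycle 1, 2026-08-17). Prose lives in docstrings only.
VERDICT OF THE CYCLE: **no kill, and none is possible short of the summit being false** (§1).

The crux is `∀ p prime, (∀ d, SchonAt p d) → Conclusion p` where
* `SchonAt p d` (the route's inlined "typed Tevelev conjecture at dimension `d`", restated verbatim in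
  §0) = every `d`-dimensional prime `I` of a Laurent ring `k[ℤ^N]`, `k = k̄` of char `p`, has finitely
  many `G_j ∉ I` such that the re-embedded principal open `U[G⁻¹] ⊆ 𝔾_m^(N+m)` has ALL initial
  degenerations `k[ℤ^(N+m)]/in_w(I')` regular (`= Literature.AlgebraicGeometry.Tropical.IsSchonIdeal I'`
  up to the `Decidable` instance of `Finsupp.filter`, see §4);
* `Conclusion p` = every integral separated scheme of finite type over an algebraically closed field
  of char `p` has a (weak) resolution (`Scheme.HasResolution`).

## Findings (each is a checked theorem below unless marked PROSE)

1. **Summit-safety (§1).** `not_schonResolves_iff`: a disproof must exhibit a prime `p` at which the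
   typed Tevelev conjecture HOLDS in every dimension AND an integral variety over some `k̄` of char `p`
   WITHOUT a weak resolution; hence `not_resolutionOfSingularities_of_not_schonResolves`:
   any refutation of this crux refutes the summit `ResolutionOfSingularities` itself (its conclusion
   block is an instance of `ResolutionInChar p`, integral ⇒ reduced). The schön hypothesis is never
   used in that direction (first observed by refuter-rattack, Attack.lean `schonResolves_of_summit`,
   evidence 2026-08-17T09:11Z). CONSEQUENCE: no `_false_without_H` lemma can exist for ANY hypothesis
   `H` of the crux while keeping the schön antecedent, because each mutated statement is still implied
   by (a believed-true strengthening of) resolution in char `p` — except for the two hypotheses of the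
   conclusion block whose removal makes the block false outright (items 2–3).
2. **`IsIntegral X` is load-bearing for the conclusion block (§2).** `conclusionWithoutIsIntegral_false`:
   witness `Spec k̄[ε] → Spec k̄`, `k̄ = AlgebraicClosure (ZMod p)` (affine ⇒ separated, quasi-compact;
   finite type; no resolution by `Literature…not_hasResolution_spec_dualNumber`). Sharper:
   `schonResolvesWithoutIsIntegral_iff` — the crux with `IsIntegral X` deleted is EQUIVALENT to
   "the typed Tevelev conjecture fails at every prime", i.e. deleting integrality turns the crux into
   the negation of the route's own target `SchonPlus` prime by prime.
3. **`LocallyOfFiniteType f` is load-bearing for the conclusion block** (PROSE + cite): the block with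
   finite type deleted fails at `Spec 𝔽_p[X]⁺` (absolute integral closure; no point outside the generic
   one has a Noetherian stalk): `Literature…not_resolutionInChar_without_locallyOfFiniteType` (over
   `𝔽_p`; the `k̄`-witness `k̄[X]⁺` is the same mechanism via
   `not_hasResolution_spec_of_forall_exists_pow_eq`, not re-formalised here — generic, low value).
4. **Not refutably load-bearing** (PROSE, §3): `IsSeparated f`, `QuasiCompact f` (weak resolutions of
   non-separated / non-quasi-compact integral `k̄`-schemes are implied by nothing in the tree but are
   not known to fail either — the proof PLAN uses both: properness of `Ū' → X` needs `X` separated,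
   and `X` quasi-compact to sit in some `ℙ^M`); `IsAlgClosed k` (dropping it gives resolution of
   integral varieties over ALL fields of char `p` from Tevelev over `k̄` — this is exactly the Descent
   cruxes 0550/0549, open, believed); `CharP k p` (structural).
5. **Hypothesis side** (PROSE, §3): (a) the antecedent `∀ d, SchonAt p d` is used by the proof plan ONLY
   at `d = dim X` — the crux can be sharpened dimensionwise
   (`∀ d, SchonAt p d → resolution of integral d-folds over k̄ of char p`), which would let partial
   progress on `SchonAt` (e.g. `SchonLowDim`, d ≤ 2, or a future d = 3) re-prove surface/threefold
   resolution through the tropical line — suggestion for the planner, not a defect; (b) the side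
   condition `∀ j, G j ∉ I` is load-bearing INSIDE the antecedent (without it `m = 1, G = 0` makes
   `I' = ⊤` and the antecedent junk-true: refuter-rattack `schonAtNoSide_trivial`), which matters for
   the crux only in that a junk-true antecedent would make the crux equivalent to
   `AlgClosedIntegralRes p` (open) rather than refutable; (c) the antecedent quantifies the initial
   degenerations over the FULL lattice `ℤ^(N+m)` although `x_i, G_j` need not generate `𝒪*(U')/k*`:
   by Luxton–Qu Lemma 2.13 (p. 6, "any characteristic" p. 5) schön in `𝔾_m^(N+m)` ⇒ schön in the
   intrinsic torus, and conversely every unit of `U' = U[G⁻¹]` is `a/G^n` with `a ∈ 𝒪(U)` a unit on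
   `U'`, so adjoining `a` as a further `G` enlarges the lattice without shrinking `U'` — the typed
   antecedent at `(p,d)` is "every d-dimensional integral very affine variety over k̄ of char p has a
   PRINCIPAL open schön in its intrinsic torus", a mild strengthening of Tevelev's Remark 3.3
   (schön-ness is not inherited by open subsets, and affine opens of an affine variety need not be
   principal — e.g. `ℙ¹×ℙ¹ ∖ (Δ ∪ fibre)` inside the affine `ℙ¹×ℙ¹ ∖ Δ`, whose class group is `ℤ`
   with the fibre a generator; whether every very affine `U` has arbitrarily small schön PRINCIPAL
   opens is exactly what the typed antecedent adds to Remark 3.3). Irrelevant to THIS crux's truth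
   (item 1) but it is what the antecedent says.
6. **Encoding sanity (§4).** The inlined initial-ideal term equals `Tropical.weightInitialIdeal`
   (`inlinedInitialIdeal_eq`, by `congr!` across the `Classical.propDecidable`/`Int.decLe` instance
   mismatch — refuter-rattack's typing finding, re-checked here so that this file carries the bridge);
   `in_0 = id` (`Tropical.weightInitialIdeal_zero`) so the `w = 0` clause is "U' regular"; off
   `Trop U'` the quotient is the zero ring and the clause is vacuous (`no_prime_of_eq_top`).
7. **Why it resists — the printed proof is characteristic-free (PROSE, audit with page cites, texts
   materialised this session).** Tevelev arXiv:math/0412329: standing hypothesis "over an algebraically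
   closed field k" (p. 3 L4 and p. 5 L4; the word "characteristic" occurs nowhere in the paper);
   Prop 2.3 (Ū proper ⇔ fan ⊇ amoeba, p. 5), Prop 2.5 (refinements of tropical pairs stay tropical,
   Ψ' = f*Ψ, p. 5), proof of Thm 1.4 ¶1 (schön ⇒ every tropical Ψ smooth: "a flat map is smooth iff
   all its geometric fibers are smooth", p. 6), Thm 1.7 (existence via the Gröbner toric variety /
   Hilbert scheme, p. 6–7), Remark 3.3 (the conjecture and "obviously implies the resolution of
   singularities", p. 8). Luxton–Qu arXiv:0902.2009: §2.1 "Let k be an algebraically closed field of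
   any characteristic" (p. 5 L5); Lemma 2.13 (p. 6); Thm 1.5 = §4 Thm 4.4 + Cor 4.5 + Lemma 4.6
   (pp. 9–10, no characteristic hypothesis; Lemma 4.7 uses "geometric fibre of the closed point is a
   reduced point ⇒ geometrically regular", fine over k̄); ONLY §3 (their Thm 1.4, the char-0 existence
   theorem from Hironaka) assumes char 0 (p. 7 L3) — and the crux does not use it. Bridge
   "typed-schön ⇒ smooth structure map" (the one step not printed in this form): for a tropical fan
   `Σ` of `U'` and `w ∈ relint σ`, pull the flat structure map `Ψ : T × Ū' → X(Σ)` back along the curve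
   `t ↦ λ_w(t)·x₀`, `λ_w(t) → x_σ`: the pullback is a closed subscheme of `𝔸¹ × T` flat over `𝔸¹`
   (so without components over `t = 0`), generic fibre `λ_w(t)·ι(U')` (`ι` = inversion), special fibre
   `{s : s⁻¹x_σ ∈ Ū' ∩ O_σ} ≅ (Ū' ∩ O_σ) × T_σ`; hence `in_w(U') ≅ (Ū' ∩ O_σ) × T_σ` up to `ι`, and
   `Ψ` (flat) is smooth iff all `in_w(U')`, `w ∈ |Σ| = Trop U'`, are smooth (= regular over k̄) — which
   is the typed antecedent. This bridge IS printed, characteristic-free: Helm–Katz arXiv:0804.3651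
   (Canad. J. Math. 2012), over an arbitrary DVR `𝒪` with residue field `k` (p. 6), Lemma 3.6 (p. 8:
   "Projection onto 𝒯 identifies m⁻¹(p) with the mod π reduction in_w X of w(π)X … in_w X ≅
   𝒯_P × (𝒳 ∩ U_P) for any w in the relative interior of P") and Prop 3.9 (pp. 8–9: "The following are
   equivalent: X is schön; in_w X is smooth for all w ∈ trop(X); for any tropical pair (X, ℙ) and any
   polyhedron P in Σ, 𝒳 ∩ U_P is smooth", proof: "since m is faithfully flat, to show it is smooth it
   suffices to show that it has smooth fibers"); the constant-coefficient case is `X_K`, `K = k((π))`.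
   Birationality witness:
   with `pr : ℤ^(M+m) → ℤ^M` and `Σ` unimodular on `Trop U'` refining `pr⁻¹(fan of ℙ^M)`, the toric
   map `φ : X(Σ) → ℙ^M` satisfies `φ⁻¹(U') ∩ Ū' = U'` (strata with `pr σ ≠ 0` map to the boundary of
   `ℙ^M`; strata with `pr σ = 0` have `w = (0, w_y)`, `w_y ≥ 0`, `≠ 0`, and map into `{∏ G_j = 0} ∩ U`),
   so `IsBirational` holds with the dense open `U' ⊆ X`; `φ|Ū'` is proper because `Ū'` is complete
   (Prop 2.3) and `X` separated — this is where `IsSeparated f` is used. FORMALISATION COST, not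
   mathematics, is the obstacle: no toric variety of a fan / closure / structure map / Gröbner-fan
   finiteness in Mathlib or Literature (grounders g70-0/g70-1, route-review refuter, all 2026-08-16).
8. **Barriers / negatives.** `ledger negatives --problem ResolutionOfSingularities`: 1 entry
   (DefectlessFrames, valuation-theoretic, unrelated). Barrier catalogue
   `Literature/Barriers/ResolutionOfSingularities/` (42 files): none concerns "schön ⇒ resolution";
   Chevalley / Artin–Schreier–Puiseux / kangaroo entries bite REACHING schön-ness (SchonPlus /
   InductiveStep), not this implication.

## HANDOFF for the next arming
(gen 2, 2026-08-17: see the section `cdisprove GEN 2` at the end of this file — landed, all ACCEPTED: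
p162869 `Negative/InitialFormMul.lean`, p168306 `Negative/AntecedentNeedsReembedding.lean`,
p169397 `Negative/AntecedentForallFalse.lean`, p169492 `Negative/AntecedentChoiceAtTorus.lean`;
nothing sorried. Lead's line `zariski-toric-closure` (PICKED.md / KERNEL.md, skeleton not yet
registered) read 2026-08-17T16:00Z: its informal stubs B–G checked on paper, no cheap kill — see
item 12.)
Filed in gen-1 cycle 1: proposal p155353 (ACCEPTED) — `Theorems/SchonResolves/Negative/SchonResolvesLoadBearing.lean`
(summit-safety `not_resolutionOfSingularities_of_not_schonResolves`; `conclusion_false_without_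
locallyOfFiniteType` with `IsIntegral` kept, witness `Spec k̄[X]⁺`; `schonResolves_without_isIntegral_
imp_not_hyp` reusing the Descent disprover's `Spec k̄[ε]` lemma). Nothing is sorried in this file. If re-armed with
stuck stubs of a line for this crux, the attackable stubs will be the DICTIONARY lemmas (typed-schön ⇒
flat/smooth structure map; Gröbner-fan finiteness; unimodular refinement compatible with `pr`): attack
their hypotheses (e.g. a "refinement stays tropical" stub stated WITHOUT properness of the toric map is
false; an "in_w constant on relint of cones of ANY fan on Trop" stub is false for fans coarser than the
Gröbner fan unless U' is schön — Luxton–Qu Thm 1.5 is exactly what repairs it).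
-/

-- single-problem summit: the doubled namespace component `ResolutionOfSingularities` is forced
set_option linter.dupNamespace false

namespace Summit.ResolutionOfSingularities.ResolutionOfSingularities.Cruxes.SchonResolves.Disproof

open scoped BigOperators Classical
open AlgebraicGeometry CategoryTheory
open Literature.AlgebraicGeometry.Resolution
open Summit.ResolutionOfSingularities.ResolutionOfSingularities.Theses.TropicalLinks

/-! ## §0 The crux, restated with names (verbatim copies of the inlined terms) -/

/-- `SchonAt p d`: the route's inlined typed Tevelev conjecture at dimension `d` in characteristic `p`
(verbatim copy of the lambda inlined in `SchonPlus` / `InductiveStep` / `SchonResolves` / `SchonLowDim`,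
elaborated under the same `open scoped Classical`). [folklore] -/
def SchonAt (p d : ℕ) : Prop :=
  ∀ (k : Type) [Field k] [CharP k p] [IsAlgClosed k] (N : ℕ) (I : Ideal (AddMonoidAlgebra k (Fin N → ℤ))), I.IsPrime → ringKrullDim (AddMonoidAlgebra k (Fin N → ℤ) ⧸ I) = (d : WithBot ℕ∞) → ∃ (m : ℕ) (G : Fin m → AddMonoidAlgebra k (Fin N → ℤ)), (∀ j, G j ∉ I) ∧ ∀ (w : Fin (N + m) → ℤ) (P : Ideal (AddMonoidAlgebra k (Fin (N + m) → ℤ) ⧸ Ideal.span ((fun f : AddMonoidAlgebra k (Fin (N + m) → ℤ) => AddMonoidAlgebra.ofCoeff (f.coeff.filter fun v => ∀ u ∈ f.coeff.support, ∑ i, w i * v i ≤ ∑ i, w i * u i)) '' (↑(Ideal.span ((fun f : AddMonoidAlgebra k (Fin N → ℤ) => (AddMonoidAlgebra.ofCoeff (f.coeff.mapDomain fun v => Fin.append v (0 : Fin m → ℤ)) : AddMonoidAlgebra k (Fin (N + m) → ℤ))) '' (↑I : Set (AddMonoidAlgebra k (Fin N → ℤ))) ∪ Set.range (fun j : Fin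 m => AddMonoidAlgebra.single (Fin.append (0 : Fin N → ℤ) (Pi.single j (1 : ℤ))) (1 : k) - AddMonoidAlgebra.ofCoeff ((G j).coeff.mapDomain fun v => Fin.append v (0 : Fin m → ℤ))))) : Set (AddMonoidAlgebra k (Fin (N + m) → ℤ)))))) [P.IsPrime], IsRegularLocalRing (Localization.AtPrime P)

/-- `Conclusion p`: resolution of INTEGRAL separated finite-type schemes over ALGEBRAICALLY CLOSED fields
of characteristic `p` (the consequent block of the crux, verbatim). [folklore] -/
def Conclusion (p : ℕ) : Prop :=
  ∀ (k : Type) [Field k] [CharP k p] [IsAlgClosed k] (X : Scheme.{0}) (f : X ⟶ Spec (.of k)),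
    IsSeparated f → LocallyOfFiniteType f → QuasiCompact f → IsIntegral X → Scheme.HasResolution X

/-- Read-back: the crux is literally `∀ p prime, (∀ d, SchonAt p d) → Conclusion p`. [folklore] -/
theorem schonResolves_iff :
    SchonResolves ↔ ∀ p : ℕ, p.Prime → (∀ d : ℕ, SchonAt p d) → Conclusion p :=
  Iff.rfl

/-! ## §1 Summit-safety: what a disproof must deliver, and that it would refute the summit -/

/-- The consequent block is an instance of `ResolutionInChar p` (integral ⇒ reduced; `k̄` is a field of
characteristic `p`). [folklore] -/
theorem conclusion_of_resolutionInChar {p : ℕ} (h : ResolutionInChar.{0} p) : Conclusion p := by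
  intro k _ _ _ X f hs hl hq hint
  exact h k X f hs hl hq inferInstance

/-- **What a disproof of the crux must exhibit**: a prime `p` at which the typed Tevelev conjecture holds
in EVERY dimension, together with a failure of resolution for some integral variety over an
algebraically closed field of characteristic `p`. [folklore] -/
theorem not_schonResolves_iff :
    ¬ SchonResolves ↔ ∃ p : ℕ, p.Prime ∧ (∀ d : ℕ, SchonAt p d) ∧ ¬ Conclusion p := by
  rw [schonResolves_iff]
  push Not
  rfl

/-- **Any refutation of `SchonResolves` refutes the summit statement** `ResolutionOfSingularities`
(resolution in every positive characteristic): the schön antecedent is simply discarded. Hence no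
hypothesis of the crux admits a `_false_without_` lemma that keeps the antecedent, unless resolution in
characteristic `p` is false. [folklore] -/
theorem not_resolutionOfSingularities_of_not_schonResolves (h : ¬ SchonResolves) :
    ¬ _root_.ResolutionOfSingularities := by
  intro hR
  obtain ⟨p, hp, -, hC⟩ := not_schonResolves_iff.mp h
  exact hC (conclusion_of_resolutionInChar (_root_.ResolutionOfSingularities_iff.mp hR p hp))

/-! ## §2 Load-bearing analysis of the consequent block: `IsIntegral X` -/

/-- The consequent block of the crux with `IsIntegral X` deleted. [folklore] -/
def ConclusionWithoutIsIntegral (p : ℕ) : Prop :=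
  ∀ (k : Type) [Field k] [CharP k p] [IsAlgClosed k] (X : Scheme.{0}) (f : X ⟶ Spec (.of k)),
    IsSeparated f → LocallyOfFiniteType f → QuasiCompact f → Scheme.HasResolution X

/-- The crux with `IsIntegral X` deleted from its consequent (antecedent kept verbatim). [folklore] -/
def SchonResolvesWithoutIsIntegral : Prop :=
  ∀ p : ℕ, p.Prime → (∀ d : ℕ, SchonAt p d) → ConclusionWithoutIsIntegral p

/-- **`IsIntegral X` (indeed `IsReduced X`) cannot be deleted from the consequent**: for every prime `p`
the block without it fails at the non-reduced point `Spec k̄[ε] → Spec k̄`, `k̄ = AlgebraicClosure 𝔽_p`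
(affine, hence separated and quasi-compact; finite, hence of finite type; no resolution because a
resolution makes some stalk of a dense open regular, hence a domain —
`not_hasResolution_spec_dualNumber`). [folklore] -/
theorem conclusionWithoutIsIntegral_false (p : ℕ) [Fact p.Prime] : ¬ ConclusionWithoutIsIntegral p := by
  intro h
  haveI : Module.Finite (AlgebraicClosure (ZMod p)) (DualNumber (AlgebraicClosure (ZMod p))) :=
    inferInstanceAs (Module.Finite (AlgebraicClosure (ZMod p))
      (AlgebraicClosure (ZMod p) × AlgebraicClosure (ZMod p)))
  let f : Spec (.of (DualNumber (AlgebraicClosure (ZMod p)))) ⟶ Spec (.of (AlgebraicClosure (ZMod p))) :=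
    Spec.map (CommRingCat.ofHom (algebraMap (AlgebraicClosure (ZMod p))
      (DualNumber (AlgebraicClosure (ZMod p)))))
  haveI : LocallyOfFiniteType f :=
    (HasRingHomProperty.Spec_iff (P := @LocallyOfFiniteType)).mpr
      (RingHom.finiteType_algebraMap.mpr inferInstance)
  exact not_hasResolution_spec_dualNumber (AlgebraicClosure (ZMod p))
    (h (AlgebraicClosure (ZMod p)) (Spec (.of (DualNumber (AlgebraicClosure (ZMod p))))) f
      inferInstance inferInstance inferInstance)

/-- **Deleting `IsIntegral X` turns the crux into the prime-by-prime NEGATION of the route's target**: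
`SchonResolvesWithoutIsIntegral` holds iff the typed Tevelev conjecture fails (in some dimension) at
every prime. In particular it is refutable exactly when `SchonPlus` holds at some prime — i.e. never by
this seat. [folklore] -/
theorem schonResolvesWithoutIsIntegral_iff :
    SchonResolvesWithoutIsIntegral ↔ ∀ p : ℕ, p.Prime → ¬ ∀ d : ℕ, SchonAt p d := by
  constructor
  · intro h p hp hS
    haveI : Fact p.Prime := ⟨hp⟩
    exact conclusionWithoutIsIntegral_false p (h p hp hS)
  · intro h p hp hS
    exact absurd hS (h p hp)

/-- The same dichotomy read on the route's target: `SchonPlus` (= `∀ p prime, ∀ d, SchonAt p d`,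
by `Iff.rfl`) at any single prime kills `SchonResolvesWithoutIsIntegral`. [folklore] -/
theorem not_schonResolvesWithoutIsIntegral_of_schonPlus (h : SchonPlus) :
    ¬ SchonResolvesWithoutIsIntegral := fun hW =>
  schonResolvesWithoutIsIntegral_iff.mp hW 2 Nat.prime_two (h 2 Nat.prime_two)

/-! ## §3 The remaining hypotheses (prose record; nothing here is refutable — see the module docstring)

* `LocallyOfFiniteType f`: load-bearing for the consequent block by
  `Literature.AlgebraicGeometry.Resolution.not_resolutionInChar_without_locallyOfFiniteType`
  (witness `Spec 𝔽_p[X]⁺`); the `k̄`-version is the same argument with `k̄[X]⁺`.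
* `IsSeparated f`, `QuasiCompact f`: used by the proof plan (properness of `Ū' → X`; `X ↪ ℙ^M`), not
  known to be necessary for the truth of the consequent; no witness exists in print.
* `IsAlgClosed k` (consequent): deleting it = adding the Descent cruxes' content; open, believed.
* antecedent `∀ d`: only `d = dim X` is used — dimensionwise sharpening available (planner's call).
-/

/-- The finite-type hypothesis of the consequent is load-bearing in the same sense, over the prime
field (re-export of the Literature fact for the reader of this file; the schön antecedent does not
mention `X` and cannot interact). [folklore] -/
theorem conclusion_false_without_locallyOfFiniteType_primeField (p : ℕ) [Fact p.Prime] :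
    ¬ ∀ (k : Type) [Field k] [CharP k p] (X : Scheme.{0}) (f : X ⟶ Spec (.of k)),
      IsSeparated f → QuasiCompact f → IsReduced X → Scheme.HasResolution X :=
  not_resolutionInChar_without_locallyOfFiniteType p

/-! ## §4 Encoding sanity of the antecedent -/

/-- **Bridge to the Literature vocabulary**: the initial-ideal term inlined by the route (elaborated under
`open scoped Classical`, so `Finsupp.filter` carries `Classical.propDecidable`) equals
`Tropical.weightInitialIdeal w J` (which carries the `Int`/`Finset` decidability instances): the two
`DecidablePred` instances are propositionally equal by `Subsingleton`, so `congr!`/`simp` closes it;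
it is NOT `rfl` (refuter-rattack, 2026-08-17). Provers: restate under `open scoped Classical` and cross
this bridge once. [folklore] -/
theorem inlinedInitialIdeal_eq {k : Type} [Field k] {n : ℕ} (w : Fin n → ℤ)
    (J : Ideal (AddMonoidAlgebra k (Fin n → ℤ))) :
    Ideal.span ((fun f : AddMonoidAlgebra k (Fin n → ℤ) =>
        AddMonoidAlgebra.ofCoeff (f.coeff.filter fun v =>
          ∀ u ∈ f.coeff.support, ∑ i, w i * v i ≤ ∑ i, w i * u i)) '' (↑J : Set _)) =
      Literature.AlgebraicGeometry.Tropical.weightInitialIdeal w J := by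
  rw [Literature.AlgebraicGeometry.Tropical.weightInitialIdeal_eq_span]
  congr! 5

/-- Off the tropical variety the clause is vacuous: if an initial ideal is the unit ideal, its quotient
is the zero ring and has no prime ideals, so `∀ P, [P.IsPrime] → …` holds for free. [folklore] -/
theorem no_prime_of_eq_top {R : Type*} [CommRing R] {J : Ideal R} (hJ : J = ⊤) (P : Ideal (R ⧸ J)) :
    ¬ P.IsPrime := by
  haveI : Subsingleton (R ⧸ J) := Ideal.Quotient.subsingleton_iff.2 hJ
  exact fun hP => hP.ne_top (Subsingleton.elim _ _)

/-- At the weight `w = 0` the inlined clause is regularity of `k[ℤ^n] ⧸ J` itself (`in_0(J) = J`):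
the antecedent forces the principal open `U[G⁻¹]` to be regular, so it has no junk witness with a
singular `U[G⁻¹]` (and `G ∉ I` prime keeps `U[G⁻¹] ≠ ∅`). [folklore] -/
theorem inlinedInitialIdeal_zero {k : Type} [Field k] {n : ℕ} (J : Ideal (AddMonoidAlgebra k (Fin n → ℤ))) :
    Ideal.span ((fun f : AddMonoidAlgebra k (Fin n → ℤ) =>
        AddMonoidAlgebra.ofCoeff (f.coeff.filter fun v =>
          ∀ u ∈ f.coeff.support, ∑ i, (0 : Fin n → ℤ) i * v i ≤ ∑ i, (0 : Fin n → ℤ) i * u i)) ''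
        (↑J : Set _)) = J := by
  rw [inlinedInitialIdeal_eq, Literature.AlgebraicGeometry.Tropical.weightInitialIdeal_zero]

/-! # cdisprove GEN 2, cycle 1 (refuter-cdisprove-stmt-ResolutionOfSingularities-17234-g2-0, 2026-08-17) — EXTENSION

Read at start: this file (§0–§4, g1), the landed `Negative/SchonResolvesLoadBearing.lean` (p155353
ACCEPTED), the item's notes/evidence (rattack Attack.lean, route-review), the sibling crux's
`Cruxes/InductiveStep/Disproof.lean` (F1–F12; its F5 names the parabola `y = (x−1)²` ON PAPER) and
the landed bricks `Theorems/TropicalLinksInductiveStep{ExtIdealPresentation, WeightZero, OffTropical,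
MonomialCriterion}.lean`, `Literature/AlgebraicGeometry/Tropical/*`.

VERDICT: still no kill and none possible (§1). What gen 2 adds is KERNEL-CHECKED content about the one
hypothesis of the crux, the antecedent `∀ d, SchonAt p d`, all LANDED under
`Theorems/SchonResolves/Negative/` (imported above; restated by name in §5–§7 below):

9. **The `∃ (m, G)` of `SchonAt` is a genuine choice — its `∀`-strengthening is FALSE at `d = 1` for
   every `p`, while the `∃` itself HOLDS at the witness instance** (`Negative/AntecedentNeedsReembedding.lean`
   p168306; `Negative/AntecedentForallFalse.lean` p169397; `Negative/AntecedentChoiceAtTorus.lean` p169492).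
   Route-native witness, over ANY field `k`: `U = 𝔾_m` (`N = 1`, `I = ⊥`, prime, `ringKrullDim = 1`),
   `m = 1`, `G = (x₁ − 1)²`. The guard `G ∉ ⊥` passes; the route's extended ideal is
   `I' = ⟨(𝕏−1)² − 𝕐⟩ ⊆ k[ℤ²]` (`reembedding_extIdeal_eq`) and is PRIME (`reembedding_extIdeal_isPrime`,
   through the landed presentation `k[ℤ²] ⧸ I' ≃ₐ[k] (k[ℤ¹] ⧸ ⊥)[G⁻¹]`), i.e. `U[G⁻¹] = 𝔾_m ∖ {1}` is a
   smooth integral curve and the clause HOLDS at `w = 0`; but at `w = (0,1)` the initial ideal is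
   `in_w I' = ⟨(𝕏−1)²⟩` (`witness_weightInitialIdeal`, by `initialIdeal_span_singleton` +
   `initialForm_mul`) and `k[x^±,y^±] ⧸ ⟨(x−1)²⟩` is regular at NO prime
   (`exists_not_isRegularLocalRing_of_eq_span_sq`: `x − 1` is a nonzero nilpotent at every prime,
   regular local rings are domains). Hence `schonClause_fails_for_reembedding` (the route's clause text
   verbatim, `open scoped Classical`) and `exists_guarded_reembedding_not_schonClause`; with the
   dimension binder discharged (`ringKrullDim_torus_rank_one`: `k[ℤ¹] ⧸ ⊥ ≃ k[T;T⁻¹]`, a localization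
   of the PID `k[X]`, not a field) this is `schonAt_one_forall_reembedding_false`. Conversely the
   EMPTY family (`m = 0`) passes the guard and SATISFIES the clause at the same `(k, 1, ⊥)`
   (`schonClause_holds_for_trivial_reembedding`: extended ideal `⊥`, `in_w(⊥) = ⊥`, the torus is
   regular — the landed brick `tropicalLinks_isSchonIdeal_bot` through the bridge
   `tropicalLinks_weightInitialIdeal_eq_span`), so the antecedent's `∃` is TRUE there
   (`exists_guarded_reembedding_schonClause`, `schonAt_one_body_holds_at_torus`: our witness does not
   make the hypothesis junk-false) and BOTH happen at one instance:
   `guarded_reembedding_choice_loadBearing : (∃ guarded (m,G), clause) ∧ (∃ guarded (m,G), ¬ clause)`.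
   READING FOR PROVERS: the clause at `w ≠ 0` sees the EMBEDDING — the lattice generated by `x` and
   the chosen `G` inside the unit lattice of `U[G⁻¹]` — not only the variety `U[G⁻¹]`; here
   `⟨x₁, (x₁−1)²⟩` has index 2 in `⟨x₁, x₁ − 1⟩` and the missing unit is exactly the non-reduced initial
   form. A proof of `SchonResolves` must therefore USE the specific `G` handed over by the antecedent
   (it fixes the torus `𝔾_m^(N+m)`, `Trop U'`, the fan and the degenerations); nothing that holds for
   all guarded re-embeddings with `U[G⁻¹]` regular can suffice. READING FOR THE PLANNER: `SchonAt`
   sits strictly between "every principal open re-embeds regularly" (trivial) and the `∀`-version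
   (false); Luxton–Qu Lemma 2.13 (schön in a torus ⇒ schön in the INTRINSIC torus) is the printed form
   of the same phenomenon, and the repair of the witness is to adjoin `x₁ − 1` as a further `G`
   (on paper: `in_w⟨y − z², z − x + 1⟩` is reduced for every `w`; not formalised — it is positive
   content for `SchonLowDim`, d = 1).
10. **Dictionary lemmas now in the tree** (`Negative/InitialFormMul.lean`, p162869 ACCEPTED):
   `initialForm_mul` (`in_φ(fg) = in_φ(f)·in_φ(g)` over coefficients without zero divisors, exponents
   with unique sums, additive weight into an ordered cancellative monoid), `initialIdeal_span_singleton`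
   (`in_φ⟨f⟩ = ⟨in_φ f⟩`: hypersurfaces), `initialForm_eq_of_forall` (characterisation),
   `exists_not_isRegularLocalRing_of_eq_span_sq`. Together with the InductiveStep bricks (w = 0 ⟺
   `U[G⁻¹]` regular; off-tropical vacuity; monomial criterion) the typed schön clause is now
   computable by hand for hypersurface re-embeddings `m = 1`, `I = ⊥` — the natural test bed for
   `SchonLowDim` and for any future counterexample search (which, by §1 and InductiveStep F12, must
   live in `d ≥ 4`).
11. **Not done / why** (for the next arming): (a) the positive half of item 9 (the intrinsic
   re-embedding `G = ((x₁−1)², x₁−1)` IS schön) needs the graph lemma `in_w⟨ι I, y_j − ι G_j⟩` for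
   non-principal `I'` — the InductiveStep lead lists it as the missing brick; (b) no stub targets were
   supplied (`line` null, `stuck_stubs` empty); when the skeleton `Lines/zariski-toric-closure.lean` is
   registered, its stubs are the targets, and item 9's witness is the first test of any stub that
   quantifies over re-embeddings.
12. **Paper triage of the lead's KERNEL.md (line `zariski-toric-closure`, informal stubs B–G; skeleton
   not yet registered), no kill, two typing traps for the stubs to come.**
   (D3) "Gröbner constancy on relative interiors, also for weights `φ : ℤ^n →+ Γ`, `Γ` any totally
   ordered abelian group": TRUE once `Σ` refines the Gröbner fan of `J` — for `φ = Σ_{i∈F} λ_i u_i`,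
   `λ_i ∈ Γ_{>0}`, Hahn-embed the finitely many relevant values; `in_φ(J)` is the iterated initial
   ideal `in_{w_ε}(J)`, `w_ε = w⁽¹⁾ + ε w⁽²⁾ + …` (a lexicographically refined weight agrees with the
   perturbed real weight on any finite set of exponent pairs: Cox–Little–O'Shea, Using Algebraic
   Geometry (2005), Ch. 8 §4, proof of Thm. (4.7), eq. (4.8), PDF pp. 400–401, held and read; cf.
   Sturmfels GBCP Prop. 1.13, not held), and the `u_i`-coefficient of `w_ε` has the sign of the first
   nonzero `λ_i⁽ʲ⁾ > 0`, so `w_ε ∈ relint σ_F`.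
   TRAP 1: the leading real weight `w⁽¹⁾` may lie on the BOUNDARY of `σ_F` (some `λ_i⁽¹⁾ = 0`), so a typed
   stub transferring constancy only to `Γ`-weights whose leading part is in `relint σ_F` is too weak for
   the empty-strata step (F, off-Trop); it must be stated through the iterated/perturbed weight.
   (F) saturation lemma `J^{(r)} = 𝔣_r ∩ B'` ("restriction to `{x_r = 0}` commutes with closure in the
   other directions"): TRUE when `Σ` refines the Gröbner fan (then `|Σ| ∩ Trop U'` is a subfan supported
   on `Trop U'`, tropical for schön `U'` by Luxton–Qu Thm 1.5, and boundary strata meet `Ū'` in pure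
   dimension `d − dim σ`, Tevelev Thm 1.4), but FALSE for a smooth complete fan that does not:
   TRAP 2 (paper counterexample, schön `U'`): `U' = {x + y + 1 = 0} ⊆ 𝔾_m²` (`Trop U'` = rays
   `e₁, e₂, −e₁−e₂`, min convention; schön, `Ū' ⊆ ℙ²` a line), `Σ` = fan of `ℙ¹ × ℙ¹` (unimodular,
   complete, the ray `−e₁−e₂` is NOT a cone: it is interior to `σ = cone(−e₁, −e₂)`). In the chart
   `B_σ = k[x', y']`, `x' = x⁻¹`, `y' = y⁻¹`: `J ∩ B_σ = ⟨x' + y' + x'y'⟩`, so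
   `A ⧸ x'A = k[y'] ⧸ ⟨y'⟩ ≠ 0` (the closure passes through the torus-fixed point `(∞, ∞)`), whereas
   `in_{−e₁}(x + y + 1) = x` is a monomial, `in_{−e₁}(J) = ⊤`, the ray degeneration along `−e₁` is
   EMPTY and `J^{(−e₁)} = ⊤`: `𝔣 ∩ B' = ⟨y'⟩ ≠ ⊤ = J^{(r)}` — the boundary divisor `D_{−e₁} ∩ Ū'` IS a
   point inside the codimension-2 stratum. So `stub_chartRegular` / the saturation lemma must carry
   (D3) for `σ` (equivalently "`Σ` refines the Gröbner fan of `J = I'` in `ℤ^(N+m)`" — of `I'`, not of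
   `I` in `ℤ^N`: item 9's lattice phenomenon) as an explicit hypothesis; stated for an arbitrary
   unimodular cone and a schön `J` it is refutable by this example (first `-- Targets` entry for the
   next arming, to be typed against the registered stub).
-/

/-! ## §5 (gen 2) The `∀`-strengthening of the antecedent is false — restated from the landed files -/

section Gen2

open scoped Classical
open Summit.ResolutionOfSingularities.ResolutionOfSingularities.Theorems.SchonResolves.Negative

/-- Item 9, route-native core (any field): some guard-passing re-embedding of `U = 𝔾_m` violates the
schön clause (landed: `exists_guarded_reembedding_not_schonClause`). [folklore] -/
theorem gen2_exists_guarded_reembedding_not_schonClause (k : Type) [Field k] :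
    ∃ (m : ℕ) (G : Fin m → AddMonoidAlgebra k (Fin 1 → ℤ)), (∀ j, G j ∉ (⊥ : Ideal (AddMonoidAlgebra k (Fin 1 → ℤ)))) ∧
      ¬ (∀ (w : Fin (1 + m) → ℤ) (P : Ideal (AddMonoidAlgebra k (Fin (1 + m) → ℤ) ⧸ Ideal.span ((fun f : AddMonoidAlgebra k (Fin (1 + m) → ℤ) => AddMonoidAlgebra.ofCoeff (f.coeff.filter fun v => ∀ u ∈ f.coeff.support, ∑ i, w i * v i ≤ ∑ i, w i * u i)) '' (↑(Ideal.span ((fun f : AddMonoidAlgebra k (Fin 1 → ℤ) => (AddMonoidAlgebra.ofCoeff (f.coeff.mapDomain fun v => Fin.append v (0 : Fin m → ℤ)) : AddMonoidAlgebra k (Fin (1 + m) → ℤ))) '' (↑(⊥ : Ideal (AddMonoidAlgebra k (Fin 1 → ℤ))) : Set (AddMonoidAlgebra k (Fin 1 → ℤ))) ∪ Set.range (fun j : Fin m => AddMonoidAlgebra.single (Fin.append (0 : Fin 1 → ℤ) (Pi.single j (1 : ℤ))) (1 : k) - AddMonoidAlgebra.ofCoeff ((G j).coeff.mapDomain fun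 v => Fin.append v (0 : Fin m → ℤ))))) : Set (AddMonoidAlgebra k (Fin (1 + m) → ℤ)))))) [P.IsPrime], IsRegularLocalRing (Localization.AtPrime P)) :=
  exists_guarded_reembedding_not_schonClause k

/-- Item 9, with the dimension binder discharged: the `∀ (m, G)`-strengthening of `SchonAt p 1` is
false for every prime `p` (landed: `schonAt_one_forall_reembedding_false`). [folklore] -/
theorem gen2_schonAt_one_forall_reembedding_false (p : ℕ) [Fact p.Prime] :
    ¬ ∀ (k : Type) [Field k] [CharP k p] [IsAlgClosed k] (N : ℕ) (I : Ideal (AddMonoidAlgebra k (Fin N → ℤ))), I.IsPrime → ringKrullDim (AddMonoidAlgebra k (Fin N → ℤ) ⧸ I) = ((1 : ℕ) : WithBot ℕ∞) → ∀ (m : ℕ) (G : Fin m → AddMonoidAlgebra k (Fin N → ℤ)), (∀ j, G j ∉ I) → ∀ (w : Fin (N + m) → ℤ) (P : Ideal (AddMonoidAlgebra k (Fin (N + m) → ℤ) ⧸ Ideal.span ((fun f : AddMonoidAlgebra k (Fin (N + m) → ℤ) => AddMonoidAlgebra.ofCoeff (f.coeff.filter fun v => ∀ u ∈ f.coeff.support,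 ∑ i, w i * v i ≤ ∑ i, w i * u i)) '' (↑(Ideal.span ((fun f : AddMonoidAlgebra k (Fin N → ℤ) => (AddMonoidAlgebra.ofCoeff (f.coeff.mapDomain fun v => Fin.append v (0 : Fin m → ℤ)) : AddMonoidAlgebra k (Fin (N + m) → ℤ))) '' (↑I : Set (AddMonoidAlgebra k (Fin N → ℤ))) ∪ Set.range (fun j : Fin m => AddMonoidAlgebra.single (Fin.append (0 : Fin N → ℤ) (Pi.single j (1 : ℤ))) (1 : k) - AddMonoidAlgebra.ofCoeff ((G j).coeff.mapDomain fun v => Fin.append v (0 : Fin m → ℤ))))) : Set (AddMonoidAlgebra k (Fin (N + m) → ℤ)))))) [P.IsPrime], IsRegularLocalRing (Localization.AtPrime P) :=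
  schonAt_one_forall_reembedding_false p

/-- Item 9, both halves at one instance (any field): at `(k, 1, ⊥)` some guarded re-embedding
satisfies the schön clause (`m = 0`) and some guarded re-embedding violates it (`(1, (x₁−1)²)`)
(landed: `guarded_reembedding_choice_loadBearing`, p169492). [folklore] -/
theorem gen2_guarded_reembedding_choice_loadBearing (k : Type) [Field k] :
    (∃ (m : ℕ) (G : Fin m → AddMonoidAlgebra k (Fin 1 → ℤ)), (∀ j, G j ∉ (⊥ : Ideal (AddMonoidAlgebra k (Fin 1 → ℤ)))) ∧
      (∀ (w : Fin (1 + m) → ℤ) (P : Ideal (AddMonoidAlgebra k (Fin (1 + m) → ℤ) ⧸ Ideal.span ((fun f : AddMonoidAlgebra k (Fin (1 + m) → ℤ) => AddMonoidAlgebra.ofCoeff (f.coeff.filter fun v => ∀ u ∈ f.coeff.support, ∑ i, w i * v i ≤ ∑ i, w i * u i)) '' (↑(Ideal.span ((fun f : AddMonoidAlgebra k (Fin 1 → ℤ) => (AddMonoidAlgebra.ofCoeff (f.coeff.mapDomain fun v => Fin.append v (0 : Fin m → ℤ)) : AddMonoidAlgebra k (Fin (1 + m) → ℤ))) '' (↑(⊥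 : Ideal (AddMonoidAlgebra k (Fin 1 → ℤ))) : Set (AddMonoidAlgebra k (Fin 1 → ℤ))) ∪ Set.range (fun j : Fin m => AddMonoidAlgebra.single (Fin.append (0 : Fin 1 → ℤ) (Pi.single j (1 : ℤ))) (1 : k) - AddMonoidAlgebra.ofCoeff ((G j).coeff.mapDomain fun v => Fin.append v (0 : Fin m → ℤ))))) : Set (AddMonoidAlgebra k (Fin (1 + m) → ℤ)))))) [P.IsPrime], IsRegularLocalRing (Localization.AtPrime P))) ∧
    (∃ (m : ℕ) (G : Fin m → AddMonoidAlgebra k (Fin 1 → ℤ)), (∀ j, G j ∉ (⊥ : Ideal (AddMonoidAlgebra k (Fin 1 → ℤ)))) ∧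
      ¬ (∀ (w : Fin (1 + m) → ℤ) (P : Ideal (AddMonoidAlgebra k (Fin (1 + m) → ℤ) ⧸ Ideal.span ((fun f : AddMonoidAlgebra k (Fin (1 + m) → ℤ) => AddMonoidAlgebra.ofCoeff (f.coeff.filter fun v => ∀ u ∈ f.coeff.support, ∑ i, w i * v i ≤ ∑ i, w i * u i)) '' (↑(Ideal.span ((fun f : AddMonoidAlgebra k (Fin 1 → ℤ) => (AddMonoidAlgebra.ofCoeff (f.coeff.mapDomain fun v => Fin.append v (0 : Fin m → ℤ)) : AddMonoidAlgebra k (Fin (1 + m) → ℤ))) '' (↑(⊥ : Ideal (AddMonoidAlgebra k (Fin 1 → ℤ))) : Set (AddMonoidAlgebra k (Fin 1 → ℤ))) ∪ Set.range (fun j : Fin m => AddMonoidAlgebra.single (Fin.append (0 : Fin 1 → ℤ) (Pi.single j (1 : ℤ))) (1 : k) - AddMonoidAlgebra.ofCoeff ((G j).coeff.mapDomain fun v => Fin.append v (0 : Fin m → ℤ))))) : Set (AddMonoidAlgebra k (Fin (1 + m) → ℤ)))))) [P.IsPrime], IsRegularLocalRing (Localization.AtPrime P))) :=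
  guarded_reembedding_choice_loadBearing k

/-- Item 9 in the tree's vocabulary: `⟨(𝕏−1)² − 𝕐⟩ ⊆ k[ℤ²]` is not a schön ideal
(landed: `witness_not_isSchonIdeal`). [folklore] -/
theorem gen2_witness_not_isSchonIdeal (k : Type) [Field k] :
    ¬ Literature.AlgebraicGeometry.Tropical.IsSchonIdeal (Ideal.span {((AddMonoidAlgebra.single (Fin.append (Pi.single (0 : Fin 1) (1 : ℤ)) (0 : Fin 1 → ℤ)) (1 : k) : AddMonoidAlgebra k (Fin (1 + 1) → ℤ)) - 1) ^ 2 - (AddMonoidAlgebra.single (Fin.append (0 : Fin 1 → ℤ) (Pi.single (0 : Fin 1) (1 : ℤ))) (1 : k) : AddMonoidAlgebra k (Fin (1 + 1) → ℤ))}) :=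
  witness_not_isSchonIdeal k

/-- Item 10: initial forms are multiplicative over a domain (landed: `initialForm_mul`), here at the
route's integer weights on `k[ℤ^n]`. [folklore] -/
theorem gen2_initialForm_mul_dotWeight {k : Type} [Field k] {n : ℕ} (w : Fin n → ℤ)
    (f g : AddMonoidAlgebra k (Fin n → ℤ)) :
    Literature.AlgebraicGeometry.Tropical.initialForm (Literature.AlgebraicGeometry.Tropical.dotWeight w) (f * g) =
      Literature.AlgebraicGeometry.Tropical.initialForm (Literature.AlgebraicGeometry.Tropical.dotWeight w) f *
        Literature.AlgebraicGeometry.Tropical.initialForm (Literature.AlgebraicGeometry.Tropical.dotWeight w) g :=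
  initialForm_mul _ (Literature.AlgebraicGeometry.Tropical.dotWeight_add w) f g

/-- Item 10: the initial ideal of a principal ideal of `k[ℤ^n]` is generated by the initial form
(landed: `initialIdeal_span_singleton`). [folklore] -/
theorem gen2_weightInitialIdeal_span_singleton {k : Type} [Field k] {n : ℕ} (w : Fin n → ℤ)
    (f : AddMonoidAlgebra k (Fin n → ℤ)) :
    Literature.AlgebraicGeometry.Tropical.weightInitialIdeal w (Ideal.span {f}) =
      Ideal.span {Literature.AlgebraicGeometry.Tropical.initialForm
        (Literature.AlgebraicGeometry.Tropical.dotWeight w) f} :=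
  initialIdeal_span_singleton _ (Literature.AlgebraicGeometry.Tropical.dotWeight_add w) f

end Gen2

end Summit.ResolutionOfSingularities.ResolutionOfSingularities.Cruxes.SchonResolves.Disproof
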